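import Mathlib
import HarnessLib
import Literature.Analysis.ODE.CompactSupportFlow
import Literature.Dynamics.TopologicalDynamics.UniformRecurrence
import Summits.NavierStokesRegularity.NavierStokesRegularity.Theorems.PoloidalWindowDoorPoloidalWindowRigidityWindow
import Summits.NavierStokesRegularity.NavierStokesRegularity.Theorems.PoloidalWindowDoorPoloidalWindowRigidityHotHullLeafLimit
import Summits.NavierStokesRegularity.NavierStokesRegularity.Theorems.PoloidalWindowDoorPoloidalWindowRigidityHotHullSlabUniform
import Summits.NavierStokesRegularity.NavierStokesRegularity.Theorems.PoloidalWindowDoorPoloidalWindowRigidityHotHullSliding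

/-!
# Route `PoloidalWindowDoor`, crux `PoloidalWindowRigidity` (K2, stmt-NavierStokesRegularity-19708) — LINE 21 «hot_hull» (ns-idea-8): BIRKHOFF RECURRENCE in a
# compact sliding-invariant family of class profiles (helper S5 of H6 `LeafRecurrence`)

Cell ns-regularity-ideate, seat ns-poloidal-K2-p2 g14 (K2 stub-worker hand, H6 under DIRECTOR-NS #288).

`exists_uniformly_recurrent`: let `Ω` be a non-empty family of profiles of the Type-I ancient mild class with one constant `C` which is
(i) SEQUENTIALLY COMPACT AND CLOSED for locally uniform convergence of every slice `t < 0` together with the vorticity slice at `t = −1`, and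
(ii) INVARIANT under SLIDING along leaves: `U ∈ Ω`, `γ` a global integral curve of `ω_U(−1,·)` through `0` ⇒ `U(·, · + γ σ) ∈ Ω` for all `σ`.
Then some `U ∈ Ω` is UNIFORMLY RECURRENT under sliding: for every `ε > 0` and every compact slab `[−(n+2), −(n+2)⁻¹] × B̄_{n+2}` the set of `σ` for
which `U(·, · + γ_U σ)` is `ε`-close to `U` on the slab (and `ω_U(−1, · + γ_U σ)` to `ω_U(−1,·)` on the ball) is relatively dense in `ℝ`.

PROOF.  The tree's Birkhoff–Furstenberg theorem `Literature.Dynamics.TopologicalDynamics.exists_isUniformlyRecurrentPt` (a non-empty compact invariant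
set of an `ℝ`-action by continuous maps carries a uniformly recurrent point) applied to the phase space `X := Ω` with the uniform structure pulled
back along `Ψ : U ↦ (n ↦ ((t,x) ↦ (U t x, ω_U(−1,x))) |_{slab n}) ∈ Π n, C(slab n, ℝ³ × ℝ³)` (countably generated, hence pseudo-metrisable and
sequential) and the sliding action `Φ_σ U := U(·, · + γ_U σ)` (`γ_U` the leaf through `0`, unique because `ω_U(−1,·)` is Lipschitz — tree
`exists_solution_real_of_lipschitz_of_bound`, `…HotHullSliding.leaf_unique`): the action law is `…HotHullSliding.rebased_leaf_of_slide`; convergence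
in `X` is slice-wise locally uniform convergence plus convergence of the vorticity slice (⇐ by `…HotHullSlabUniform.tendstoUniformlyOn_slab`, the
class-uniform KNSS moduli); `X` is compact by (i) (`IsSeqCompact.isCompact`); `Φ_σ` is sequentially continuous by the Grönwall lemma
`…HotHullLeafLimit.tendsto_rebased_curves` (class-uniform speed bound `…HotHullSlabUniform.exists_uniform_curl_bounds`) and
`…HotHullSliding.tendstoLocallyUniformly_comp_add`; syndetic return sets are relatively dense (`isSyndetic_iff_exists_window`).

WHAT THIS IS NOT: not a claim about Navier–Stokes regularity — topological dynamics for a support of a PASSed research decomposition of ⟨19708⟩'s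
residues (bears_on LADDER-NS N0, rung N0-LocalTubeDoorPoloidal); research cells OPEN; crux 19708 / item 20428 OPEN; NS regularity NOT proved.
-/

noncomputable section

-- the summit and its single sub-problem share the name (CONVENTIONS §1), as in every Theorems file
set_option linter.dupNamespace false

namespace Summit.NavierStokesRegularity.NavierStokesRegularity.Theorems.PoloidalWindowDoorPoloidalWindowRigidityHotHullRecurrence

open Set Function Filter Topology Metric
open scoped NNReal Uniformity Topology
open Literature.Analysis Literature.Analysis.FluidPDE Literature.Analysis.UnboundedOperators
open Literature.Dynamics.TopologicalDynamics
open Summit.NavierStokesRegularity.NavierStokesRegularity.Theorems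
open PoloidalWindowDoorPoloidalWindowRigidityHotHullLeafLimit PoloidalWindowDoorPoloidalWindowRigidityHotHullSlabUniform
  PoloidalWindowDoorPoloidalWindowRigidityHotHullSliding

/-- **Birkhoff recurrence in a compact sliding-invariant family of class profiles.**  See the module docstring. -/
theorem exists_uniformly_recurrent (C : ℝ) (Ω : Set (ℝ → EuclideanSpace ℝ (Fin 3) → EuclideanSpace ℝ (Fin 3))) (hne : Ω.Nonempty)
    (hcls : ∀ U ∈ Ω, HasTypeITimeDecay C U ∧ ContinuousOn (uncurry U) (Iio (0 : ℝ) ×ˢ univ) ∧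
      (∀ s t : ℝ, s < t → t < 0 → ∀ x, U t x = heatExtension (U s) (t - s) x - oseenDuhamel 1 s U U t x) ∧
      (∀ t < 0, VectorCalculus.IsDivFree (U t)))
    (hcpt : ∀ Us : ℕ → ℝ → EuclideanSpace ℝ (Fin 3) → EuclideanSpace ℝ (Fin 3), (∀ k, Us k ∈ Ω) →
      ∃ (φ : ℕ → ℕ) (U : ℝ → EuclideanSpace ℝ (Fin 3) → EuclideanSpace ℝ (Fin 3)), StrictMono φ ∧ U ∈ Ω ∧
        (∀ t < 0, TendstoLocallyUniformly (fun j => Us (φ j) t) (U t) atTop) ∧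
        TendstoLocallyUniformly (fun j => curl (Us (φ j) (-1))) (curl (U (-1))) atTop)
    (hinv : ∀ U ∈ Ω, ∀ γ : ℝ → EuclideanSpace ℝ (Fin 3), γ 0 = 0 → (∀ σ, HasDerivAt γ (curl (U (-1)) (γ σ)) σ) →
      ∀ σ : ℝ, (fun t x => U t (x + γ σ)) ∈ Ω) :
    ∃ U ∈ Ω, ∃ γ : ℝ → EuclideanSpace ℝ (Fin 3), γ 0 = 0 ∧ (∀ σ, HasDerivAt γ (curl (U (-1)) (γ σ)) σ) ∧
      ∀ ε : ℝ, 0 < ε → ∀ n : ℕ, ∃ L : ℝ, 0 < L ∧ ∀ a : ℝ, ∃ σ ∈ Icc a (a + L),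
        (∀ t ∈ Icc (-((n : ℝ) + 2)) (-((n : ℝ) + 2)⁻¹), ∀ x ∈ closedBall (0 : EuclideanSpace ℝ (Fin 3)) ((n : ℝ) + 2),
          dist (U t (x + γ σ)) (U t x) < ε) ∧
        (∀ x ∈ closedBall (0 : EuclideanSpace ℝ (Fin 3)) ((n : ℝ) + 2), dist (curl (U (-1)) (x + γ σ)) (curl (U (-1)) x) < ε) := by
  classical
  -- class-uniform vorticity bounds, continuity, leaves
  obtain ⟨B, K, hBK⟩ := exists_uniform_curl_bounds C
  have hB : ∀ U ∈ Ω, ∀ x, ‖curl (U (-1)) x‖ ≤ B := fun U hU =>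
    (hBK (hcls U hU).1 (hcls U hU).2.1 (hcls U hU).2.2.1 (hcls U hU).2.2.2).1
  have hK : ∀ U ∈ Ω, LipschitzWith K (curl (U (-1))) := fun U hU =>
    (hBK (hcls U hU).1 (hcls U hU).2.1 (hcls U hU).2.2.1 (hcls U hU).2.2.2).2
  have hcurlc : ∀ U ∈ Ω, Continuous (curl (U (-1))) := fun U hU => (hK U hU).continuous
  have hslice : ∀ U ∈ Ω, ∀ t < 0, Continuous (U t) := fun U hU t ht =>
    ((PoloidalWindowDoorPoloidalWindowRigidityWindow.isTypeIAncientMild_of_class (hcls U hU).1 (hcls U hU).2.1 (hcls U hU).2.2.1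
      (hcls U hU).2.2.2).analyticOnNhd_slice_univ ht).continuous
  have hleafex : ∀ U ∈ Ω, ∃ γ : ℝ → EuclideanSpace ℝ (Fin 3), γ 0 = 0 ∧ ∀ σ, HasDerivAt γ (curl (U (-1)) (γ σ)) σ :=
    fun U hU => Literature.Analysis.ODE.exists_solution_real_of_lipschitz_of_bound (hK U hU) (hB U hU) 0
  -- the phase space, the leaves, the sliding action
  let X := {U : ℝ → EuclideanSpace ℝ (Fin 3) → EuclideanSpace ℝ (Fin 3) // U ∈ Ω}
  let leaf : X → ℝ → EuclideanSpace ℝ (Fin 3) := fun U => Classical.choose (hleafex U.1 U.2)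
  have hleaf0 : ∀ U : X, leaf U 0 = 0 := fun U => (Classical.choose_spec (hleafex U.1 U.2)).1
  have hleaf : ∀ U : X, ∀ σ, HasDerivAt (leaf U) (curl (U.1 (-1)) (leaf U σ)) σ := fun U =>
    (Classical.choose_spec (hleafex U.1 U.2)).2
  let ϕ : ℝ → X → X := fun σ U => ⟨fun t x => U.1 t (x + leaf U σ), hinv U.1 U.2 (leaf U) (hleaf0 U) (hleaf U) σ⟩
  have hϕval : ∀ σ (U : X), (ϕ σ U).1 = fun t x => U.1 t (x + leaf U σ) := fun σ U => rfl
  have hleaf_slide : ∀ (U : X) (σ : ℝ), leaf (ϕ σ U) = fun σ' => leaf U (σ + σ') - leaf U σ := fun U σ =>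
    leaf_unique (hK _ (ϕ σ U).2) (hleaf (ϕ σ U)) (rebased_leaf_of_slide (hleaf U) σ).2
      (by rw [hleaf0]; exact (rebased_leaf_zero _ _).symm)
  have hadd : ∀ s t (U : X), ϕ (s + t) U = ϕ s (ϕ t U) := by
    intro s t U
    apply Subtype.ext
    show (fun τ y => U.1 τ (y + leaf U (s + t))) = fun τ y => (ϕ t U).1 τ (y + leaf (ϕ t U) s)
    rw [hleaf_slide U t, hϕval]
    funext τ y
    show U.1 τ (y + leaf U (s + t)) = U.1 τ (y + (leaf U (t + s) - leaf U t) + leaf U t)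
    rw [add_assoc, sub_add_cancel, add_comm s t]
  -- the compact slabs and the embedding `Ψ`
  let Sn : ℕ → Set (ℝ × EuclideanSpace ℝ (Fin 3)) := fun n =>
    Icc (-((n : ℝ) + 2)) (-((n : ℝ) + 2)⁻¹) ×ˢ closedBall (0 : EuclideanSpace ℝ (Fin 3)) ((n : ℝ) + 2)
  have hSnc : ∀ n, IsCompact (Sn n) := fun n => isCompact_Icc.prod (isCompact_closedBall _ _)
  haveI hSncs : ∀ n, CompactSpace (Sn n) := fun n => isCompact_iff_compactSpace.1 (hSnc n)
  have hn2 : ∀ n : ℕ, (1 : ℝ) ≤ (n : ℝ) + 2 := fun n => by have := n.cast_nonneg (α := ℝ); linarith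
  have hSn_neg : ∀ n, ∀ p ∈ Sn n, p.1 < 0 := fun n p hp => by
    have h1 : p.1 ≤ -((n : ℝ) + 2)⁻¹ := (mem_prod.1 hp).1.2
    have h2 : (0 : ℝ) < ((n : ℝ) + 2)⁻¹ := by positivity
    linarith
  have hm1 : ∀ n : ℕ, (-1 : ℝ) ∈ Icc (-((n : ℝ) + 2)) (-((n : ℝ) + 2)⁻¹) := fun n =>
    ⟨by linarith [hn2 n], by rw [neg_le_neg_iff]; exact inv_le_one_of_one_le₀ (hn2 n)⟩
  have hΨc : ∀ (U : X) (n : ℕ), Continuous fun p : Sn n => (U.1 p.1.1 p.1.2, curl (U.1 (-1)) p.1.2) := fun U n => by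
    refine Continuous.prodMk ?_ ((hcurlc U.1 U.2).comp (continuous_snd.comp continuous_subtype_val))
    exact (hcls U.1 U.2).2.1.comp_continuous continuous_subtype_val fun p => ⟨hSn_neg n p.1 p.2, mem_univ _⟩
  let Ψ : X → ((n : ℕ) → C(Sn n, EuclideanSpace ℝ (Fin 3) × EuclideanSpace ℝ (Fin 3))) := fun U n =>
    ⟨fun p => (U.1 p.1.1 p.1.2, curl (U.1 (-1)) p.1.2), hΨc U n⟩
  have hΨ1 : ∀ (U : X) (n : ℕ) (p : Sn n), (Ψ U n p).1 = U.1 p.1.1 p.1.2 := fun U n p => rfl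
  have hΨ2 : ∀ (U : X) (n : ℕ) (p : Sn n), (Ψ U n p).2 = curl (U.1 (-1)) p.1.2 := fun U n p => rfl
  -- the phase-space topology: pulled back along `Ψ` (countably generated ⇒ pseudo-metrisable ⇒ sequential)
  letI uX : UniformSpace X := UniformSpace.comap Ψ inferInstance
  letI tX : TopologicalSpace X := uX.toTopologicalSpace
  haveI hcg : IsCountablyGenerated (𝓤 X) := by
    show IsCountablyGenerated 𝓤[UniformSpace.comap Ψ inferInstance]
    rw [uniformity_comap]
    infer_instance
  haveI : TopologicalSpace.PseudoMetrizableSpace X := inferInstance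
  haveI : Nonempty X := ⟨⟨hne.some, hne.some_mem⟩⟩
  have hΨind : Topology.IsInducing Ψ := ⟨rfl⟩
  -- convergence in `X` = uniform convergence of every `Ψ · n`
  have hconvX : ∀ {Us : ℕ → X} {U : X}, Tendsto Us atTop (𝓝 U) ↔
      ∀ n, TendstoUniformly (fun k (p : Sn n) => Ψ (Us k) n p) (Ψ U n) atTop := by
    intro Us U
    rw [hΨind.tendsto_nhds_iff, tendsto_pi_nhds]
    exact forall_congr' fun n => ContinuousMap.tendsto_iff_tendstoUniformly
  -- … implies slice-wise locally uniform convergence and convergence of the vorticity slice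
  have hX_to_slices : ∀ {Us : ℕ → X} {U : X}, Tendsto Us atTop (𝓝 U) →
      (∀ t < 0, TendstoLocallyUniformly (fun k => (Us k).1 t) (U.1 t) atTop) ∧
      TendstoLocallyUniformly (fun k => curl ((Us k).1 (-1))) (curl (U.1 (-1))) atTop := by
    intro Us U h
    rw [hconvX] at h
    constructor
    · intro t ht
      rw [tendstoLocallyUniformly_iff_forall_isCompact]
      intro Kc hKc
      obtain ⟨r, hr⟩ := hKc.isBounded.subset_closedBall 0
      obtain ⟨n, hn⟩ := exists_nat_ge (max (max r (-t)) (-t)⁻¹)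
      have hnr : r ≤ (n : ℝ) + 2 := by linarith [le_max_left (max r (-t)) (-t)⁻¹, le_max_left r (-t)]
      have ht1 : -((n : ℝ) + 2) ≤ t := by linarith [le_max_left (max r (-t)) (-t)⁻¹, le_max_right r (-t)]
      have ht2 : t ≤ -((n : ℝ) + 2)⁻¹ := by
        have h1 : (-t)⁻¹ ≤ (n : ℝ) + 2 := by linarith [le_max_right (max r (-t)) (-t)⁻¹]
        have h2 : ((n : ℝ) + 2)⁻¹ ≤ -t := inv_le_of_inv_le₀ (by linarith) h1
        linarith
      rw [Metric.tendstoUniformlyOn_iff]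
      intro ε hε
      filter_upwards [Metric.tendstoUniformly_iff.1 (h n) ε hε] with k hk x hx
      have hp : (t, x) ∈ Sn n := mem_prod.2 ⟨⟨ht1, ht2⟩, closedBall_subset_closedBall hnr (hr hx)⟩
      have h1 := hk ⟨(t, x), hp⟩
      rw [Prod.dist_eq, max_lt_iff] at h1
      exact h1.1
    · rw [tendstoLocallyUniformly_iff_forall_isCompact]
      intro Kc hKc
      obtain ⟨r, hr⟩ := hKc.isBounded.subset_closedBall 0
      obtain ⟨n, hn⟩ := exists_nat_ge r
      have hnr : r ≤ (n : ℝ) + 2 := by linarith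
      rw [Metric.tendstoUniformlyOn_iff]
      intro ε hε
      filter_upwards [Metric.tendstoUniformly_iff.1 (h n) ε hε] with k hk x hx
      have hp : ((-1 : ℝ), x) ∈ Sn n := mem_prod.2 ⟨hm1 n, closedBall_subset_closedBall hnr (hr hx)⟩
      have h1 := hk ⟨((-1 : ℝ), x), hp⟩
      rw [Prod.dist_eq, max_lt_iff] at h1
      exact h1.2
  -- … and follows from them (class-uniform moduli: `tendstoUniformlyOn_slab`)
  have hslices_to_X : ∀ {Us : ℕ → X} {U : X}, (∀ t < 0, TendstoLocallyUniformly (fun k => (Us k).1 t) (U.1 t) atTop) →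
      TendstoLocallyUniformly (fun k => curl ((Us k).1 (-1))) (curl (U.1 (-1))) atTop → Tendsto Us atTop (𝓝 U) := by
    intro Us U hsl hcu
    rw [hconvX]
    intro n
    have hslab := tendstoUniformlyOn_slab C (u := fun k => (Us k).1) (U := U.1) (fun k => (hcls _ (Us k).2).1)
      (fun k => (hcls _ (Us k).2).2.1) (fun k => (hcls _ (Us k).2).2.2.1) (fun k => (hcls _ (Us k).2).2.2.2) (hcls _ U.2).1
      (hcls _ U.2).2.1 (hcls _ U.2).2.2.1 (hcls _ U.2).2.2.2 (fun t ht x => (hsl t ht).tendsto_comp ((hslice _ U.2 t ht).continuousAt) tendsto_const_nhds) (hn2 n)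
    have hcurlU := (tendstoLocallyUniformly_iff_forall_isCompact.1 hcu) _
      (isCompact_closedBall (0 : EuclideanSpace ℝ (Fin 3)) ((n : ℝ) + 2))
    rw [Metric.tendstoUniformly_iff]
    intro ε hε
    filter_upwards [Metric.tendstoUniformlyOn_iff.1 hslab ε hε, Metric.tendstoUniformlyOn_iff.1 hcurlU ε hε] with k hk1 hk2 p
    rw [Prod.dist_eq, max_lt_iff]
    exact ⟨hk1 p.1 p.2, hk2 p.1.2 (mem_prod.1 p.2).2⟩
  -- compactness of the phase space
  have hseq : IsSeqCompact (univ : Set X) := by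
    intro Us _
    obtain ⟨φ, U, hφ, hUΩ, hsl, hcu⟩ := hcpt (fun k => (Us k).1) (fun k => (Us k).2)
    exact ⟨⟨U, hUΩ⟩, mem_univ _, φ, hφ, hslices_to_X (Us := Us ∘ φ) (U := ⟨U, hUΩ⟩) hsl hcu⟩
  have hcompact : IsCompact (univ : Set X) := hseq.isCompact
  -- continuity of the sliding maps
  have hcontϕ : ∀ σ, Continuous (ϕ σ) := by
    intro σ
    refine continuous_iff_seqContinuous.2 fun Us U h => ?_
    obtain ⟨hsl, hcu⟩ := hX_to_slices h
    have hlf : Tendsto (fun k => leaf (Us k) σ) atTop (𝓝 (leaf U σ)) :=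
      tendsto_rebased_curves (X := fun k => curl ((Us k).1 (-1))) (Y := curl (U.1 (-1))) (hK _ U.2) (B := B)
        (fun k x => hB _ (Us k).2 x) hcu (c := fun k => leaf (Us k)) (fun k σ => hleaf (Us k) σ) (fun k => hleaf0 (Us k))
        (hleaf U) (hleaf0 U) σ
    apply hslices_to_X
    · intro t ht
      show TendstoLocallyUniformly (fun k => (ϕ σ (Us k)).1 t) ((ϕ σ U).1 t) atTop
      exact tendstoLocallyUniformly_comp_add (hsl t ht) (hslice _ U.2 t ht) hlf
    · show TendstoLocallyUniformly (fun k => curl ((ϕ σ (Us k)).1 (-1))) (curl ((ϕ σ U).1 (-1))) atTop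
      have e1 : (fun k => curl ((ϕ σ (Us k)).1 (-1))) = fun k x => curl ((Us k).1 (-1)) (x + leaf (Us k) σ) := by
        funext k
        exact curl_slide ((Us k).1 (-1)) (leaf (Us k) σ)
      have e2 : curl ((ϕ σ U).1 (-1)) = fun x => curl (U.1 (-1)) (x + leaf U σ) := curl_slide (U.1 (-1)) (leaf U σ)
      rw [e1, e2]
      exact tendstoLocallyUniformly_comp_add hcu (hcurlc _ U.2) hlf
  -- Birkhoff–Furstenberg: a uniformly recurrent point
  obtain ⟨Ustar, -, hrec⟩ := exists_isUniformlyRecurrentPt (G := ℝ) (ϕ := ϕ) hcontϕ hadd hcompact univ_nonempty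
    (fun σ => mapsTo_univ _ _)
  refine ⟨Ustar.1, Ustar.2, leaf Ustar, hleaf0 Ustar, hleaf Ustar, fun ε hε n => ?_⟩
  set N : Set X := Ψ ⁻¹' {y | y n ∈ ball (Ψ Ustar n) ε} with hN
  have hNo : IsOpen N := (isOpen_ball.preimage (continuous_apply n)).preimage hΨind.continuous
  have hNmem : Ustar ∈ N := by
    show Ψ Ustar n ∈ ball (Ψ Ustar n) ε
    exact mem_ball_self hε
  obtain ⟨L, hL, hwin⟩ := isSyndetic_iff_exists_window.1 (hrec N (hNo.mem_nhds hNmem))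
  refine ⟨L, hL, fun a => ?_⟩
  obtain ⟨σ, hσ, hσN⟩ := hwin a
  have hd : dist (Ψ (ϕ σ Ustar) n) (Ψ Ustar n) < ε := by
    have : Ψ (ϕ σ Ustar) n ∈ ball (Ψ Ustar n) ε := hσN
    exact mem_ball.1 this
  have hpt : ∀ p : Sn n, dist ((Ψ (ϕ σ Ustar) n) p) ((Ψ Ustar n) p) < ε := fun p =>
    (ContinuousMap.dist_apply_le_dist p).trans_lt hd
  refine ⟨σ, hσ, fun t ht x hx => ?_, fun x hx => ?_⟩
  · have h := hpt ⟨(t, x), mem_prod.2 ⟨ht, hx⟩⟩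
    rw [Prod.dist_eq, max_lt_iff] at h
    exact h.1
  · have h := hpt ⟨((-1 : ℝ), x), mem_prod.2 ⟨hm1 n, hx⟩⟩
    rw [Prod.dist_eq, max_lt_iff] at h
    have h2 := h.2
    rw [hΨ2, hΨ2] at h2
    have e : curl ((ϕ σ Ustar).1 (-1)) = fun x => curl (Ustar.1 (-1)) (x + leaf Ustar σ) := curl_slide (Ustar.1 (-1)) (leaf Ustar σ)
    rw [e] at h2
    exact h2

end Summit.NavierStokesRegularity.NavierStokesRegularity.Theorems.PoloidalWindowDoorPoloidalWindowRigidityHotHullRecurrence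

end
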